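import Summits.ResolutionOfSingularities.ResolutionOfSingularities.Theorems.HilbertSamuelEliminationSigmaMaxModificationsCorridor3WLadderGradeOneUnitsTower
import Summits.ResolutionOfSingularities.ResolutionOfSingularities.Theorems.HilbertSamuelEliminationSigmaMaxModificationsCorridor3InducesIsoOnPoint
import Summits.ResolutionOfSingularities.ResolutionOfSingularities.Theorems.HilbertSamuelEliminationSigmaMaxModificationsCorridor3WLadderRationalNearStep
import Literature.AlgebraicGeometry.CossartJannsenSaito2020.KeyTheoremsLocalLinks
import Literature.AlgebraicGeometry.CossartJannsenSaito2020.ProjDirLine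
import Literature.AlgebraicGeometry.Resolution.PermissibleBlowupDirectrixRational
import Literature.AlgebraicGeometry.Resolution.OneDimensionalBlowupTower
import Literature.AlgebraicGeometry.Resolution.EffectiveCartierStalks
import Literature.AlgebraicGeometry.Resolution.SigmaMaxEliminationInDim
import Literature.AlgebraicGeometry.Resolution.BlowupReducedDimension
import HarnessLib

/-!
# [OURS · L1 W4.2] Local near-point chains — LOCAL SCHEMES AND ONE BLOW-UP: the step centre of a local near-point step is the
# reduced closed point, it is permissible as soon as a point lies over it (reduced local ring), and a near point over it forces
# `1 ≤ e` (CJS Thm. 3.14); transfers of `H`, `e`, `ē`, isolation along isomorphisms — scheme bookkeeping for the (K) KILL ROW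
# of card H `generic-point-descent` (crux chain w42 `SigmaMaxModificationsCorridor3` stmt-ResolutionOfSingularities-19249,
# W4.2 DEAL D6; `--supports stmt-ResolutionOfSingularities-19249`, helper)

OURS (cell res-hironaka, LADDER-RESOLUTION rung L, slot W4.2; seat res-D-pv-046 AS res-L1-s46-pv-9, res-L1-w42-plan-1's W4.2
DEAL 2026-08-27 D6). NOT statements of H. Hironaka's manuscript [Hironaka2017] — nothing of it is used or asserted here; the one
printed input is Cossart–Jannsen–Saito's Thm. 3.14 [CossartJannsenSaito2020] as the tree's named fact
`CossartJannsenSaito2020_thm_3_14` (statement-only, taken as a hypothesis BY NAME). AI-drafted, weaker than expert review.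
Sorry-free PROOF file, no definitions.

## Contents (namespace `…SigmaMaxModificationsCorridor3.Moving.LocalChains`)

§1 Local schemes (`IsLocalAt`, CJS p. 107 «`X = Spec(𝒪_{X,x})`»): every point generizes the closed point
   (`specializes_of_isLocalAt`); the closed point is closed; **an ideal sheaf with stalk `𝔪_s` at the closed point IS `𝓘({s})`**
   (`eq_vanishingIdeal_singleton_of_isLocalAt` — res-L1-w42-tri-1's caution (ii) «`supp D = {s}` is automatic on a local
   scheme»); `dim S = dim 𝒪_{S,s}`; excellence of `S` from excellence of `𝒪_{S,s}` (Matsumura §32); the stalk isomorphism behind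
   `IsLocalSchemeAt`.
§2 One blow-up: **no point of a blow-up lies over a centre point with ZERO stalk ideal** (the exceptional divisor is an effective
   Cartier divisor, Görtz–Wedhorn Def. 13.90); in a reduced local ring a maximal ideal which is a minimal prime is zero; hence a
   point over the reduced closed point `{s}` of a scheme with reduced `𝒪_{S,s}` forces `{s}` PERMISSIBLE (CJS Def. 3.1 (2), tree
   `isPermissible_vanishingIdeal_singleton_iff`); a NEAR point over a permissible point centre of an excellent scheme forces
   `1 ≤ e_s` (CJS Thm. 3.14 in the tree's numerical form: `dim 𝒪_{{s},s} = 0 < e_s`; p. 98 Step 9 «if `e_x(X) = 0`, then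
   `X_1(ν̃) = ∅`»).
§3 Transfers: `H^N`, `e`, `ē` along isomorphisms of local rings; **isolation in the Hilbert–Samuel locus along an isomorphism of
   schemes** and from a local scheme `S` to `Spec 𝒪_{S,s}`; `CharHypothesis` is automatic in dimension `≤ 2`.

Consumers: `…Corridor3WLadderLocalChainsTowers.lean` (the towers) and `…Corridor3WLadderLocalChainsTerminate.lean` (the row).

## References

* V. Cossart, U. Jannsen, S. Saito, *Desingularization: Invariants and Strategy*, LNM 2270 (2020): p. 98 Step 9, Def. 2.26,
  Def. 2.28, Def. 3.1 (2), Thm. 3.14, Def. 13.3, p. 107. [CossartJannsenSaito2020]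
* U. Görtz, T. Wedhorn, *Algebraic Geometry I* (2nd ed. 2020), Def. 13.90. [GortzWedhorn2020]
* H. Matsumura, *Commutative Ring Theory* (1987), §32. [Matsumura1987]
* The Stacks Project, Tag 01J7. [StacksProject]
-/

noncomputable section

-- namespace `…Corridor3.Moving` re-enters `…Corridor3` (module convention of the Moving files)
set_option linter.dupNamespace false

open CategoryTheory CategoryTheory.Limits AlgebraicGeometry TopologicalSpace IsLocalRing
open Literature.AlgebraicGeometry.Resolution Literature.RingTheory.HilbertSamuel
open Literature.AlgebraicGeometry.CossartJannsenSaito2020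
open Scheme.IdealSheafData

universe u

namespace Summit.ResolutionOfSingularities.ResolutionOfSingularities.Theorems.SigmaMaxModificationsCorridor3.Moving

namespace LocalChains

/-! ## §1 Local schemes: every point generizes the closed point; the step centre is the reduced closed point -/

/-- On a scheme local at `s`, every point specialises to `s` (Stacks 01J7: the image of `Spec 𝒪_{S,s} → S` is the set
of generizations of `s`, and here that map is surjective). [folklore] -/
theorem specializes_of_isLocalAt {S : Scheme.{u}} {s : S} (h : IsLocalAt S s) (x : S) : x ⤳ s := by
  haveI : IsIso (S.fromSpecStalk s) := h
  have hx : x ∈ Set.range (S.fromSpecStalk s).base :=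
    (ConcreteCategory.bijective_of_isIso (S.fromSpecStalk s).base).2.range_eq ▸ Set.mem_univ x
  rw [Scheme.range_fromSpecStalk] at hx
  exact hx

/-- On a scheme local at `s`, the point `s` is closed. [folklore] -/
theorem isClosed_singleton_of_isLocalAt {S : Scheme.{u}} {s : S} (h : IsLocalAt S s) :
    IsClosed ({s} : Set S) := by
  rw [← closure_eq_iff_isClosed]
  ext x
  constructor
  · intro hx
    have h1 : s ⤳ x := specializes_iff_mem_closure.mpr hx
    exact Set.mem_singleton_iff.mpr ((specializes_of_isLocalAt h x).antisymm h1).eq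
  · intro hx
    rw [Set.mem_singleton_iff] at hx
    subst hx
    exact subset_closure rfl

/-- **On a local scheme an ideal sheaf with stalk `𝔪_s` at the closed point IS the ideal of the reduced closed point**
(the stalk at a generization `x ⤳ s` is the extension of the stalk at `s`, tree `stalkIdeal_map_stalkSpecializes`;
ideal sheaves are determined by their stalks, tree `ext_of_forall_stalkIdeal_eq`). This is res-L1-w42-tri-1's caution
(ii) «`supp D = {s}` is automatic on a local scheme». [folklore] -/
theorem eq_vanishingIdeal_singleton_of_isLocalAt {S : Scheme.{u}} {s : S} (h : IsLocalAt S s)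
    (hs : IsClosed ({s} : Set S)) {D : S.IdealSheafData} (hD : stalkIdeal D s = maximalIdeal (S.presheaf.stalk s)) :
    D = vanishingIdeal ⟨{s}, hs⟩ := by
  refine ext_of_forall_stalkIdeal_eq fun x => ?_
  have hx : x ⤳ s := specializes_of_isLocalAt h x
  rw [← stalkIdeal_map_stalkSpecializes D hx, ← stalkIdeal_map_stalkSpecializes (vanishingIdeal ⟨{s}, hs⟩) hx, hD,
    stalkIdeal_vanishingIdeal_singleton hs]

/-- The topological dimension of a scheme local at `s` is the Krull dimension of `𝒪_{S,s}`. [folklore] -/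
theorem topologicalKrullDim_eq_of_isLocalAt {S : Scheme.{u}} {s : S} (h : IsLocalAt S s) :
    topologicalKrullDim S = ringKrullDim (S.presheaf.stalk s) := by
  haveI : IsIso (S.fromSpecStalk s) := h
  let e := asIso (S.fromSpecStalk s)
  have h1 : topologicalKrullDim ↥(Spec (S.presheaf.stalk s)) ≤ topologicalKrullDim S :=
    e.hom.isEmbedding.isInducing.topologicalKrullDim_le
  have h2 : topologicalKrullDim S ≤ topologicalKrullDim ↥(Spec (S.presheaf.stalk s)) :=
    e.inv.isEmbedding.isInducing.topologicalKrullDim_le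
  have h3 : topologicalKrullDim ↥(Spec (S.presheaf.stalk s)) = ringKrullDim (S.presheaf.stalk s) :=
    PrimeSpectrum.topologicalKrullDim_eq_ringKrullDim (S.presheaf.stalk s)
  exact le_antisymm (h2.trans h3.le) (h3.ge.trans h1)

/-- A scheme local at `s` with excellent local ring `𝒪_{S,s}` is excellent (Matsumura §32; transport along
`Spec 𝒪_{S,s} ≅ S`). [cite: Matsumura1987, §32 p. 260] -/
theorem isExcellent_of_isLocalAt {S : Scheme.{u}} [IsLocallyNoetherian S] {s : S} (h : IsLocalAt S s)
    (hR : IsExcellentRing (S.presheaf.stalk s)) : Scheme.IsExcellent S := by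
  haveI : IsIso (S.fromSpecStalk s) := h
  let e := asIso (S.fromSpecStalk s)
  exact Scheme.IsExcellent.of_locallyOfFiniteType e.inv (Scheme.isExcellent_Spec_of_isExcellentRing _ hR)

/-- The local rings at the two ends of `IsLocalSchemeAt Y y X x` are isomorphic: `𝒪_{Y,y} ≅ 𝒪_{X,x}`. [folklore] -/
theorem nonempty_stalkIso_of_isLocalSchemeAt {Y : Scheme.{u}} {y : Y} {X : Scheme.{u}} {x : X}
    (h : IsLocalSchemeAt Y y X x) : Nonempty (Y.presheaf.stalk y ≅ X.presheaf.stalk x) := by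
  obtain ⟨e, he⟩ := h
  -- `𝒪_{Y,y} ≅ 𝒪_{Spec 𝒪_{X,x}, e y} = 𝒪_{Spec 𝒪_{X,x}, 𝔪} ≅ 𝒪_{X,x}`
  refine ⟨(asIso (e.hom.stalkMap y)).symm ≪≫ (Spec (X.presheaf.stalk x)).presheaf.stalkCongr (Inseparable.of_eq he) ≪≫
    stalkClosedPointIso (X.presheaf.stalk x)⟩



/-! ## §2 One blow-up: no point lies over a centre point with zero stalk ideal; reduced local rings of dimension `0` -/

/-- **No point of a blow-up lies over a point of the centre at which the centre's stalk ideal is zero**: the exceptional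
ideal `I·𝒪_{X'}` is an effective Cartier divisor, so its stalk at `x'` is generated by a non-zero-divisor of the (non-trivial)
local ring `𝒪_{X',x'}`, and it is the extension of `I_{π x'}`. [cite: GortzWedhorn2020, Def. 13.90] -/
theorem stalkIdeal_ne_bot_of_isBlowup {X X' : Scheme.{u}} {π : X' ⟶ X} {I : X.IdealSheafData} (hπ : IsBlowup π I)
    (x' : X') : stalkIdeal I (π.base x') ≠ ⊥ := by
  intro hbot
  obtain ⟨g, hg, hgen⟩ := hπ.isEffectiveCartier.mem_cartierLocus x'
  rw [stalkIdeal_comap_eq_map_stalkMap, hbot, Ideal.map_bot] at hgen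
  have hg0 : g = 0 := by
    have : g ∈ (⊥ : Ideal (X'.presheaf.stalk x')) := hgen ▸ Ideal.mem_span_singleton_self g
    simpa using this
  rw [hg0] at hg
  exact zero_notMem_nonZeroDivisors hg

/-- In a REDUCED local ring whose maximal ideal is a minimal prime, the maximal ideal is zero (it is then the only
prime, hence the nilradical). [folklore] -/
theorem maximalIdeal_eq_bot_of_mem_minimalPrimes {A : Type u} [CommRing A] [IsLocalRing A] [IsReduced A]
    (h : maximalIdeal A ∈ minimalPrimes A) : maximalIdeal A = ⊥ := by
  refine le_bot_iff.mp fun a ha => ?_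
  have hnil : a ∈ nilradical A := by
    rw [nilradical_eq_sInf, Ideal.mem_sInf]
    intro J hJ
    haveI : J.IsPrime := hJ
    have hle : maximalIdeal A ≤ J := h.2 ⟨hJ, bot_le⟩ (IsLocalRing.le_maximalIdeal hJ.ne_top)
    exact hle ha
  exact (mem_nilradical.mp hnil).eq_zero

/-- **Along a blow-up `π : B → S` of a scheme `S` with REDUCED local ring at a closed point `s`, in the reduced point `{s}`,
the existence of a point `b` over `s` forces the centre `{s}` to be PERMISSIBLE** (CJS Def. 3.1 (2)): otherwise `𝔪_s` is a
minimal prime, hence zero, and no point lies over `s` (`stalkIdeal_ne_bot_of_isBlowup`). [cite: CossartJannsenSaito2020, Def. 3.1 (2)] -/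
theorem isPermissible_singleton_of_over {S B : Scheme.{u}} [IsLocallyNoetherian S] {s : S} (hs : IsClosed ({s} : Set S))
    [IsReduced (S.presheaf.stalk s)] {π : B ⟶ S} (hπ : IsBlowup π (vanishingIdeal ⟨{s}, hs⟩)) {b : B}
    (hb : π.base b = s) : IdealSheafData.IsPermissible (vanishingIdeal (⟨{s}, hs⟩ : Closeds S)) := by
  rw [isPermissible_vanishingIdeal_singleton_iff hs]
  intro hmin
  have h0 : maximalIdeal (S.presheaf.stalk s) = ⊥ := maximalIdeal_eq_bot_of_mem_minimalPrimes hmin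
  have hne := stalkIdeal_ne_bot_of_isBlowup hπ b
  rw [hb, stalkIdeal_vanishingIdeal_singleton hs, h0] at hne
  exact hne rfl

/-- With a permissible point centre on an excellent scheme, a NEAR point over it forces `1 ≤ e` (CJS Thm. 3.14, numerical
form: `dim 𝒪_{{s},s} = 0 < e_s`). [cite: CossartJannsenSaito2020, Thm. 3.14, p. 98 Step 9] -/
theorem one_le_dirDim_of_near (h314 : CossartJannsenSaito2020_thm_3_14.{u}) {S B : Scheme.{u}} [IsLocallyNoetherian S]
    (hexc : Scheme.IsExcellent S) {N : ℕ} (hdim : topologicalKrullDim S ≤ (N : WithBot ℕ∞)) {s : S}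
    (hs : IsClosed ({s} : Set S)) {π : B ⟶ S} (hπ : IsBlowup π (vanishingIdeal ⟨{s}, hs⟩))
    (hperm : IdealSheafData.IsPermissible (vanishingIdeal (⟨{s}, hs⟩ : Closeds S))) (hchar : CharHypothesis S s) {b : B}
    (hb : π.base b = s) (hnear : Scheme.hsFun B N b = Scheme.hsFun S N s) : 1 ≤ Scheme.dirDim S s := by
  subst hb
  have hsupp : π.base b ∈ (vanishingIdeal (⟨{π.base b}, hs⟩ : Closeds S)).support := by
    rw [← SetLike.mem_coe, Scheme.IdealSheafData.coe_support_vanishingIdeal]; exact Set.mem_singleton _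
  have hlt := h314 S B π (vanishingIdeal ⟨{π.base b}, hs⟩) hexc hperm hπ N hdim b hsupp hchar hnear
  rw [stalkIdeal_vanishingIdeal_singleton hs] at hlt
  -- `𝒪/𝔪` is a field: dimension `0`
  have h0 : ringKrullDim (S.presheaf.stalk (π.base b) ⧸ maximalIdeal (S.presheaf.stalk (π.base b))) = 0 := by
    letI := Ideal.Quotient.field (maximalIdeal (S.presheaf.stalk (π.base b)))
    exact ringKrullDim_eq_zero_of_field _
  rw [h0] at hlt
  by_contra hlt1
  push Not at hlt1
  have : Scheme.dirDim S (π.base b) = 0 := by omega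
  rw [this] at hlt
  exact lt_irrefl _ (by exact_mod_cast hlt)


/-! ## §3 Transfers along isomorphisms of schemes and of local rings -/

/-- `H^N` agrees at the two ends of an isomorphism of local rings. [cite: CossartJannsenSaito2020, Def. 2.28] -/
theorem hsFun_eq_of_nonempty_stalkIso {X Y : Scheme.{u}} [IsLocallyNoetherian X] [IsLocallyNoetherian Y] {x : X} {y : Y}
    (e : Nonempty (X.presheaf.stalk x ≅ Y.presheaf.stalk y)) (N : ℕ) : Scheme.hsFun X N x = Scheme.hsFun Y N y :=
  hsFun_eq_of_stalkIso e.some N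

/-- **Isolation in the Hilbert–Samuel locus transfers along an isomorphism of schemes.** [folklore] -/
theorem isIsolatedInHSMaxLocus_of_iso {X Y : Scheme.{u}} [IsLocallyNoetherian X] [IsLocallyNoetherian Y] (f : X ⟶ Y)
    [IsIso f] {N : ℕ} {x : X} (h : IsIsolatedInHSMaxLocus Y N (f.base x)) : IsIsolatedInHSMaxLocus X N x := by
  have hH : ∀ x' : X, Scheme.hsFun X N x' = Scheme.hsFun Y N (f.base x') := fun x' =>
    Scheme.hsFun_eq_of_isIso_stalkMap f N x'
  have hbij : Function.Bijective f.base := ConcreteCategory.bijective_of_isIso f.base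
  have hvals : Scheme.hsValues X N = Scheme.hsValues Y N := by
    ext v
    simp only [Scheme.hsValues, Set.mem_range]
    constructor
    · rintro ⟨x', rfl⟩; exact ⟨f.base x', (hH x').symm⟩
    · rintro ⟨y', rfl⟩
      obtain ⟨x', rfl⟩ := hbij.2 y'
      exact ⟨x', hH x'⟩
  have hmax : ∀ x' : X, x' ∈ Scheme.hsMaxLocus X N ↔ f.base x' ∈ Scheme.hsMaxLocus Y N := fun x' => by
    simp only [Scheme.hsMaxLocus, Set.mem_setOf_eq, hvals, hH]
  obtain ⟨U, hU, hUx⟩ := h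
  refine ⟨f.base ⁻¹' U, hU.preimage f.continuous, ?_⟩
  ext x'
  simp only [Set.mem_inter_iff, Set.mem_preimage, Set.mem_singleton_iff]
  constructor
  · rintro ⟨hU', hmax'⟩
    have : f.base x' ∈ U ∩ Scheme.hsMaxLocus Y N := ⟨hU', (hmax x').mp hmax'⟩
    rw [hUx, Set.mem_singleton_iff] at this
    exact hbij.1 this
  · rintro rfl
    have : f.base x' ∈ U ∩ Scheme.hsMaxLocus Y N := by rw [hUx]; exact Set.mem_singleton _
    exact ⟨this.1, (hmax x').mpr this.2⟩

/-- Isolation in the Hilbert–Samuel locus of a scheme LOCAL at `s` is isolation of the closed point of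
`Spec 𝒪_{S,s}` (transfer along the isomorphism `Spec 𝒪_{S,s} ⥲ S`). [cite: CossartJannsenSaito2020, Def. 13.3, p. 107] -/
theorem isIsolatedInHSMaxLocus_spec_of_isLocalAt {S : Scheme.{u}} [IsLocallyNoetherian S] {s : S} (hloc : IsLocalAt S s)
    {N : ℕ} (h : IsIsolatedInHSMaxLocus S N s) :
    IsIsolatedInHSMaxLocus (Spec (S.presheaf.stalk s)) N (closedPoint (S.presheaf.stalk s)) := by
  haveI : IsIso (S.fromSpecStalk s) := hloc
  refine isIsolatedInHSMaxLocus_of_iso (S.fromSpecStalk s) ?_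
  rw [Scheme.fromSpecStalk_closedPoint]
  exact h

/-- `CharHypothesis` is automatic in dimension `≤ 2` (`d + 2 ≤ 2p` for every prime `p` once `d ≤ 2`).
[cite: CossartJannsenSaito2020, Thm. 10.2] -/
theorem charHypothesis_of_dim_le_two {X : Scheme.{u}} (x : X)
    (hd : topologicalKrullDim ↥X ≤ (2 : WithBot ℕ∞)) : CharHypothesis X x := by
  have hd' : topologicalKrullDim ↥X ≤ ((2 : ℕ) : WithBot ℕ∞) := by exact_mod_cast hd
  obtain ⟨d, hdX, hd2⟩ := exists_topologicalKrullDim_eq x hd'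
  refine ⟨d, hdX, ?_⟩
  rcases CharP.char_is_prime_or_zero (ResidueField (X.presheaf.stalk x))
      (ringChar (ResidueField (X.presheaf.stalk x))) with h | h
  · exact Or.inr (by have := h.two_le; omega)
  · exact Or.inl h

end LocalChains

end Summit.ResolutionOfSingularities.ResolutionOfSingularities.Theorems.SigmaMaxModificationsCorridor3.Moving

end
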